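import Literature.NumberTheory.Sieve.LinearEquationsInPrimes
import Mathlib.Analysis.Convex.Topology
import Mathlib.MeasureTheory.Measure.Lebesgue.Basic
import HarnessLib

/-!
# Linear equations in primes: the one-dimensional setting (`d = 1`)

Topic `Literature/NumberTheory/Sieve`. Everything here is PROVED. For Green–Tao's data in dimension
`d = 1` (`LinearEquationsInPrimes.lean`: the box `latticeBox 1 N = [-N, N]`, real points, convex bodies
`K ⊆ [-N, N] ⊆ ℝ¹`, the archimedean factor `β_∞ = vol(K ∩ {ψ_i > 0})`) everything reduces to intervals
of integers and of reals (sub-namespace `DimOne`):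

* `eval_eq`, `realEval_eq` — `ψ(n) = a n₀ + b`;
* `card_filter_latticeBox` — counts over the box `[-N, N]¹` are counts over `[-N, N] ⊆ ℤ`;
* `archFactor_eq` — `β_∞` is the length (Lebesgue measure on `ℝ`) of the SLICE
  `{r : (r) ∈ K, ψ_i(r) > 0 ∀ i}`;
* `convex_slice`, `convex_setOf_pos` — the slice of a convex body and a half-line `{a r + b > 0}` are
  convex, hence order-connected (`Convex.ordConnected`);
* `exists_filter_eq_Icc` — **lattice points of an interval**: for an order-connected `S ⊆ [-N, N]`
  the integers `m ∈ [-N, N]` with `m ∈ S` form an integer interval `[m₁, m₂]`, and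
  `|#[m₁, m₂] − vol(S)| ≤ 1`;
* `card_filter_Icc_eq_card_filter_Ioc` (with `card_filter_Icc_neg`) — **values of a progression**:
  for `a > 0` and `a m₁ + b > 0` the values `a m + b`, `m ∈ [m₁, m₂]`, are the members of the class
  `b (mod a)` in `(a(m₁ − 1) + b, a m₂ + b]`, so a count over `m` is a count over an AP segment
  (`a < 0` is reduced to `a > 0` by `m ↦ −m`).

## References

* B. Green, T. Tao, *Linear equations in primes*, Ann. of Math. 171 (2010), §1. [GreenTao2010]
-/

noncomputable section

open Finset MeasureTheory Set

namespace Literature.NumberTheory.Sieve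

namespace DimOne

variable {t : ℕ}

/-! ### Forms, boxes and the archimedean factor in dimension one -/

/-- `ψ(n) = a n₀ + b` for a form on `ℤ¹`. [folklore] -/
theorem eval_eq (ψ : AffLinForm 1) (n : Fin 1 → ℤ) : ψ.eval n = ψ.coeff 0 * n 0 + ψ.const := by
  simp [AffLinForm.eval]

/-- `ψ(x) = a x₀ + b` for the real extension of a form on `ℤ¹`. [folklore] -/
theorem realEval_eq (ψ : AffLinForm 1) (x : Fin 1 → ℝ) :
    ψ.realEval x = (ψ.coeff 0 : ℝ) * x 0 + ψ.const := by
  simp [AffLinForm.realEval]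

/-- Counts over the box `[-N, N]¹` are counts over the integer interval `[-N, N]`
(`n ↦ n₀`, `m ↦ (m)`). [folklore] -/
theorem card_filter_latticeBox (N : ℕ) (Q : (Fin 1 → ℤ) → Prop) [DecidablePred Q] :
    #((latticeBox 1 N).filter Q) = #((Finset.Icc (-(N : ℤ)) N).filter (fun m => Q (fun _ => m))) := by
  refine Finset.card_nbij' (fun n => n 0) (fun m _ => m) (fun n hn => ?_) (fun m hm => ?_)
    (fun n _ => ?_) (fun m _ => rfl)
  · rw [Finset.mem_coe, Finset.mem_filter] at hn ⊢
    have h1 : n = fun _ => n 0 := by funext i; rw [Fin.fin_one_eq_zero i]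
    refine ⟨?_, h1 ▸ hn.2⟩
    exact Fintype.mem_piFinset.mp hn.1 0
  · rw [Finset.mem_coe, Finset.mem_filter] at hm ⊢
    exact ⟨Fintype.mem_piFinset.mpr fun _ => hm.1, hm.2⟩
  · funext i; simp [Fin.fin_one_eq_zero i]

/-- The real point of `(m) ∈ ℤ¹` is `(m) ∈ ℝ¹`. [folklore] -/
theorem realPoint_const (m : ℤ) : realPoint (fun _ : Fin 1 => m) = fun _ => (m : ℝ) := rfl

/-- **The archimedean factor in dimension one**: `β_∞(Ψ, K)` is the length of the slice
`{r ∈ ℝ : (r) ∈ K, ψ_i((r)) > 0 ∀ i}` (the measurable equivalence `ℝ¹ ≃ ℝ` preserves Lebesgue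
measure). [cite: GreenTao2010, (1.4)] -/
theorem archFactor_eq (Ψ : Fin t → AffLinForm 1) (K : Set (Fin 1 → ℝ)) :
    archFactor Ψ K =
      (volume {r : ℝ | (fun _ : Fin 1 => r) ∈ K ∧ ∀ i, 0 < (Ψ i).realEval (fun _ => r)}).toReal := by
  unfold archFactor
  congr 1
  set e := MeasurableEquiv.funUnique (Fin 1) ℝ with he
  have hmp : MeasurePreserving e volume volume := volume_preserving_funUnique (Fin 1) ℝ
  set S : Set (Fin 1 → ℝ) := K ∩ {x | ∀ i, 0 < (Ψ i).realEval x} with hS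
  have hpre : e ⁻¹' {r : ℝ | (fun _ : Fin 1 => r) ∈ K ∧ ∀ i, 0 < (Ψ i).realEval (fun _ => r)} = S := by
    ext x
    have hx : (fun _ : Fin 1 => x 0) = x := by funext i; rw [Fin.fin_one_eq_zero i]
    simp only [Set.mem_preimage, Set.mem_setOf_eq, hS, Set.mem_inter_iff]
    change ((fun _ : Fin 1 => x 0) ∈ K ∧ ∀ i, 0 < (Ψ i).realEval (fun _ => x 0)) ↔ _
    rw [hx]
  rw [← hpre, ← MeasurableEquiv.map_apply e, hmp.map_eq]

/-! ### Convexity -/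

/-- The slice `{r : (r) ∈ K}` of a convex `K ⊆ ℝ¹` is convex. [folklore] -/
theorem convex_slice {K : Set (Fin 1 → ℝ)} (hK : Convex ℝ K) :
    Convex ℝ {r : ℝ | (fun _ : Fin 1 => r) ∈ K} := by
  intro x hx y hy a b ha hb hab
  have h := hK hx hy ha hb hab
  have heq : a • (fun _ : Fin 1 => x) + b • (fun _ : Fin 1 => y) = fun _ => a • x + b • y := by
    funext i; simp
  rw [heq] at h
  exact h

/-- A half-line `{r : 0 < a r + b}` is convex. [folklore] -/
theorem convex_setOf_pos (a b : ℝ) : Convex ℝ {r : ℝ | 0 < a * r + b} := by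
  have h : {r : ℝ | 0 < a * r + b} = (fun r => a * r + b) ⁻¹' Set.Ioi 0 := rfl
  rw [h]
  refine Convex.affine_preimage (AffineMap.mk (fun r => a * r + b) (LinearMap.mulLeft ℝ a) ?_)
    (convex_Ioi 0)
  intro p v
  simp only [LinearMap.mulLeft_apply, vadd_eq_add]
  ring

/-! ### Lattice points of an interval -/

/-- **Lattice points of an interval.** Let `S ⊆ [-N, N]` be order-connected (an interval). Then the
integers `m ∈ [-N, N]` with `m ∈ S` form an integer interval `[m₁, m₂]` (possibly empty), and their
number differs from the length of `S` by at most `1`: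
`S ⊇ [m₁, m₂]` and `S ⊆ [m₁ − 1, m₂ + 1]` by order-connectedness and the extremality of `m₁, m₂`
(an `S` without integer points lies in some `[k, k + 1]`). [folklore] -/
theorem exists_filter_eq_Icc {N : ℕ} {S : Set ℝ} [DecidablePred (· ∈ S)] (hS : S.OrdConnected)
    (hSN : S ⊆ Set.Icc (-(N : ℝ)) N) :
    ∃ m₁ m₂ : ℤ, (Finset.Icc (-(N : ℤ)) N).filter (fun m : ℤ => ((m : ℤ) : ℝ) ∈ S) =
        Finset.Icc m₁ m₂ ∧
      |(#(Finset.Icc m₁ m₂) : ℝ) - (volume S).toReal| ≤ 1 := by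
  set I := (Finset.Icc (-(N : ℤ)) N).filter (fun m : ℤ => ((m : ℤ) : ℝ) ∈ S) with hI
  have hmemI : ∀ m : ℤ, m ∈ I ↔ (m : ℝ) ∈ S := by
    intro m
    rw [hI, Finset.mem_filter, Finset.mem_Icc]
    constructor
    · exact fun h => h.2
    · intro h
      have h' := hSN h
      rw [Set.mem_Icc] at h'
      refine ⟨⟨?_, ?_⟩, h⟩
      · exact_mod_cast h'.1
      · exact_mod_cast h'.2
  -- `vol S ≤ vol [α, β]` whenever `S ⊆ [α, β]`
  have hvol_le : ∀ α β : ℝ, S ⊆ Set.Icc α β → α ≤ β → (volume S).toReal ≤ β - α := by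
    intro α β h hαβ
    refine ENNReal.toReal_le_of_le_ofReal (by linarith) ?_
    calc volume S ≤ volume (Set.Icc α β) := measure_mono h
      _ = ENNReal.ofReal (β - α) := Real.volume_Icc
  rcases I.eq_empty_or_nonempty with hemp | hne
  · -- no integer point: `S ⊆ [k, k+1]`
    refine ⟨1, 0, ?_, ?_⟩
    · rw [hemp]; exact (Finset.Icc_eq_empty_of_lt (by norm_num)).symm
    · rw [Finset.Icc_eq_empty_of_lt (by norm_num), Finset.card_empty, Nat.cast_zero, zero_sub,
        abs_neg, abs_of_nonneg ENNReal.toReal_nonneg]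
      rcases S.eq_empty_or_nonempty with hS0 | ⟨s, hs⟩
      · rw [hS0, measure_empty, ENNReal.toReal_zero]; exact zero_le_one
      · have hsub : S ⊆ Set.Icc (⌊s⌋ : ℝ) (⌊s⌋ + 1) := by
          intro t ht
          rw [Set.mem_Icc]
          by_contra hcon
          rw [not_and_or, not_le, not_le] at hcon
          rcases hcon with hlt | hlt
          · -- `⌊s⌋ ∈ [t, s] ⊆ S`
            have hmem : ((⌊s⌋ : ℤ) : ℝ) ∈ S :=
              hS.out ht hs ⟨hlt.le, Int.floor_le s⟩
            have : (⌊s⌋ : ℤ) ∈ I := (hmemI _).mpr hmem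
            rw [hemp] at this
            exact Finset.notMem_empty _ this
          · -- `⌊s⌋ + 1 ∈ [s, t] ⊆ S`
            have hmem : ((⌊s⌋ + 1 : ℤ) : ℝ) ∈ S := by
              refine hS.out hs ht ⟨?_, ?_⟩
              · push_cast; exact (Int.lt_floor_add_one s).le
              · push_cast; exact hlt.le
            have : (⌊s⌋ + 1 : ℤ) ∈ I := (hmemI _).mpr hmem
            rw [hemp] at this
            exact Finset.notMem_empty _ this
        have := hvol_le _ _ hsub (by linarith)
        linarith
  · -- `I = [m₁, m₂]` with `m₁ = min I`, `m₂ = max I`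
    set m₁ := I.min' hne with hm₁
    set m₂ := I.max' hne with hm₂
    have hm₁I : m₁ ∈ I := Finset.min'_mem I hne
    have hm₂I : m₂ ∈ I := Finset.max'_mem I hne
    have hm₁S : (m₁ : ℝ) ∈ S := (hmemI _).mp hm₁I
    have hm₂S : (m₂ : ℝ) ∈ S := (hmemI _).mp hm₂I
    have hm₁₂ : m₁ ≤ m₂ := Finset.min'_le I m₂ hm₂I
    have hIeq : I = Finset.Icc m₁ m₂ := by
      ext m
      rw [Finset.mem_Icc]
      constructor
      · intro hm
        exact ⟨Finset.min'_le I m hm, Finset.le_max' I m hm⟩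
      · rintro ⟨h1, h2⟩
        refine (hmemI m).mpr (hS.out hm₁S hm₂S ⟨?_, ?_⟩)
        · exact_mod_cast h1
        · exact_mod_cast h2
    refine ⟨m₁, m₂, hIeq, ?_⟩
    have hcard : (#(Finset.Icc m₁ m₂) : ℝ) = (m₂ : ℝ) - m₁ + 1 := by
      rw [Int.card_Icc]
      have : ((m₂ + 1 - m₁).toNat : ℤ) = m₂ + 1 - m₁ := Int.toNat_of_nonneg (by omega)
      have h' : (((m₂ + 1 - m₁).toNat : ℕ) : ℝ) = ((m₂ + 1 - m₁ : ℤ) : ℝ) := by exact_mod_cast this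
      rw [h']
      push_cast
      ring
    -- upper bound: `S ⊆ [m₁ − 1, m₂ + 1]`
    have hsub : S ⊆ Set.Icc ((m₁ : ℝ) - 1) (m₂ + 1) := by
      intro t ht
      rw [Set.mem_Icc]
      by_contra hcon
      rw [not_and_or, not_le, not_le] at hcon
      rcases hcon with hlt | hlt
      · have hmem : ((m₁ - 1 : ℤ) : ℝ) ∈ S := by
          refine hS.out ht hm₁S ⟨?_, ?_⟩
          · push_cast; exact hlt.le
          · push_cast; linarith
        have h1 : m₁ - 1 ∈ I := (hmemI _).mpr hmem
        have h2 := Finset.min'_le I _ h1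
        rw [← hm₁] at h2
        omega
      · have hmem : ((m₂ + 1 : ℤ) : ℝ) ∈ S := by
          refine hS.out hm₂S ht ⟨?_, ?_⟩
          · push_cast; linarith
          · push_cast; exact hlt.le
        have h1 : m₂ + 1 ∈ I := (hmemI _).mpr hmem
        have h2 := Finset.le_max' I _ h1
        rw [← hm₂] at h2
        omega
    have hup : (volume S).toReal ≤ (m₂ : ℝ) - m₁ + 2 := by
      have hm : ((m₁ : ℝ)) ≤ m₂ := by exact_mod_cast hm₁₂
      have := hvol_le _ _ hsub (by linarith)
      linarith
    -- lower bound: `[m₁, m₂] ⊆ S`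
    have hlow : (m₂ : ℝ) - m₁ ≤ (volume S).toReal := by
      have hsub' : Set.Icc (m₁ : ℝ) m₂ ⊆ S := hS.out hm₁S hm₂S
      have hfin : volume S ≠ ⊤ := by
        refine ne_top_of_le_ne_top (b := volume (Set.Icc ((m₁ : ℝ) - 1) (m₂ + 1))) ?_
          (measure_mono hsub)
        rw [Real.volume_Icc]
        exact ENNReal.ofReal_ne_top
      rw [← ENNReal.ofReal_le_iff_le_toReal hfin, ← Real.volume_Icc]
      exact measure_mono hsub'
    rw [hcard, abs_le]
    constructor <;> linarith

/-! ### Values of a progression over an integer interval -/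

/-- Reflection `m ↦ −m`: a count over `[m₁, m₂]` of a function of `a m + b` is the same count over
`[−m₂, −m₁]` for `(−a) m + b`. [folklore] -/
theorem card_filter_Icc_neg (a b m₁ m₂ : ℤ) (R : ℤ → Prop) [DecidablePred R] :
    #((Finset.Icc m₁ m₂).filter (fun m => R (a * m + b))) =
      #((Finset.Icc (-m₂) (-m₁)).filter (fun m => R (-a * m + b))) := by
  refine Finset.card_nbij' (fun m => -m) (fun m => -m) (fun m hm => ?_) (fun m hm => ?_)
    (fun m _ => by ring) (fun m _ => by ring)
  · simp only [Finset.mem_coe, Finset.mem_filter, Finset.mem_Icc] at hm ⊢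
    refine ⟨⟨by omega, by omega⟩, ?_⟩
    rw [show -a * -m + b = a * m + b by ring]
    exact hm.2
  · simp only [Finset.mem_coe, Finset.mem_filter, Finset.mem_Icc] at hm ⊢
    refine ⟨⟨by omega, by omega⟩, ?_⟩
    rw [show a * -m + b = -a * m + b by ring]
    exact hm.2

/-- **Values of a progression.** For `a > 0` and `a m₁ + b > 0`, the values `a m + b`, `m ∈ [m₁, m₂]`,
are exactly the members of the residue class of `a m₂ + b` modulo `a` in the segment
`(a(m₁ − 1) + b, a m₂ + b]` of `ℕ` (lower end truncated at `0` by `Int.toNat` if negative), so that a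
count over `m` of a property of the value is the same count over the AP segment. [folklore] -/
theorem card_filter_Icc_eq_card_filter_Ioc {a b m₁ m₂ : ℤ} (ha : 0 < a) (hpos : 0 < a * m₁ + b)
    (R : ℕ → Prop) [DecidablePred R] :
    #((Finset.Icc m₁ m₂).filter (fun m => R (a * m + b).toNat)) =
      #((Finset.Ioc (a * (m₁ - 1) + b).toNat (a * m₂ + b).toNat).filter
        (fun v => v ≡ (a * m₂ + b).toNat [MOD a.toNat] ∧ R v)) := by
  have hlow : a * (m₁ - 1) + b = a * m₁ + b - a := by ring
  have e3 : ((a.toNat : ℕ) : ℤ) = a := Int.toNat_of_nonneg ha.le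
  -- from a member `v` of the segment we read off `0 ≤ a m₂ + b` and `v = a (m₂ - k) + b`
  have hseg : ∀ v : ℕ, (a * (m₁ - 1) + b).toNat < v → v ≤ (a * m₂ + b).toNat →
      v ≡ (a * m₂ + b).toNat [MOD a.toNat] →
        0 ≤ a * m₂ + b ∧ ∃ k : ℤ, (v : ℤ) = a * (m₂ - k) + b ∧ m₁ ≤ m₂ - k ∧ 0 ≤ k := by
    intro v h1 h2 hmod
    have hV2 : 0 ≤ a * m₂ + b := by
      by_contra h
      push Not at h
      have : (a * m₂ + b).toNat = 0 := Int.toNat_eq_zero.mpr h.le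
      omega
    have e1 : ((a * m₂ + b).toNat : ℤ) = a * m₂ + b := Int.toNat_of_nonneg hV2
    rw [Nat.modEq_iff_dvd, e1, e3] at hmod
    obtain ⟨k, hk⟩ := hmod
    have hv : (v : ℤ) = a * (m₂ - k) + b := by linarith
    have hv2 : (v : ℤ) ≤ a * m₂ + b := by omega
    have hv1 : a * m₁ + b - a < v := by omega
    refine ⟨hV2, k, hv, ?_, ?_⟩
    · by_contra hcon
      push Not at hcon
      have : a * (m₂ - k) ≤ a * (m₁ - 1) := by nlinarith
      nlinarith
    · by_contra hcon
      push Not at hcon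
      nlinarith
  refine Finset.card_nbij' (fun m => (a * m + b).toNat) (fun v => ((v : ℤ) - b) / a)
    (fun m hm => ?_) (fun v hv => ?_) (fun m hm => ?_) (fun v hv => ?_)
  · -- `m ↦ a m + b` lands in the segment and the class
    dsimp only
    rw [Finset.mem_coe, Finset.mem_filter, Finset.mem_Icc] at hm
    rw [Finset.mem_coe, Finset.mem_filter, Finset.mem_Ioc]
    obtain ⟨⟨h1, h2⟩, hR⟩ := hm
    have hv0 : 0 < a * m + b := by nlinarith
    have hlt : a * m₁ + b - a < a * m + b := by nlinarith
    have hle : a * m + b ≤ a * m₂ + b := by nlinarith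
    refine ⟨⟨?_, ?_⟩, ?_, hR⟩
    · rw [hlow]; omega
    · omega
    · -- `a m + b ≡ a m₂ + b (mod a)`
      rw [Nat.modEq_iff_dvd]
      have e1 : ((a * m₂ + b).toNat : ℤ) = a * m₂ + b := Int.toNat_of_nonneg (by nlinarith)
      have e2 : ((a * m + b).toNat : ℤ) = a * m + b := Int.toNat_of_nonneg hv0.le
      rw [e1, e2, e3]
      exact ⟨m₂ - m, by ring⟩
  · -- a member `v` of the class in the segment comes from `m = (v - b)/a ∈ [m₁, m₂]`
    dsimp only
    rw [Finset.mem_coe, Finset.mem_filter, Finset.mem_Ioc] at hv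
    rw [Finset.mem_coe, Finset.mem_filter, Finset.mem_Icc]
    obtain ⟨⟨h1, h2⟩, hmod, hR⟩ := hv
    obtain ⟨-, k, hvk, hk1, hk0⟩ := hseg v h1 h2 hmod
    have hdiv : ((v : ℤ) - b) / a = m₂ - k := by
      rw [hvk, add_sub_cancel_right, Int.mul_ediv_cancel_left _ ha.ne']
    rw [hdiv]
    refine ⟨⟨hk1, by omega⟩, ?_⟩
    have : (a * (m₂ - k) + b).toNat = v := by rw [← hvk, Int.toNat_natCast]
    rw [this]
    exact hR
  · -- left inverse
    rw [Finset.mem_coe, Finset.mem_filter, Finset.mem_Icc] at hm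
    have hv0 : 0 ≤ a * m + b := by nlinarith
    change (((a * m + b).toNat : ℤ) - b) / a = m
    rw [Int.toNat_of_nonneg hv0, add_sub_cancel_right, Int.mul_ediv_cancel_left _ ha.ne']
  · -- right inverse
    rw [Finset.mem_coe, Finset.mem_filter, Finset.mem_Ioc] at hv
    obtain ⟨⟨h1, h2⟩, hmod, -⟩ := hv
    obtain ⟨-, k, hvk, -, -⟩ := hseg v h1 h2 hmod
    change (a * (((v : ℤ) - b) / a) + b).toNat = v
    rw [hvk, add_sub_cancel_right, Int.mul_ediv_cancel_left _ ha.ne', ← hvk, Int.toNat_natCast]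

end DimOne

end Literature.NumberTheory.Sieve
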